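import Mathlib
import Literature.AlgebraicGeometry.HyperbolicPolynomials.HyperbolicityCone
import Literature.AlgebraicGeometry.HyperbolicPolynomials.LineDerivatives
import Literature.AlgebraicGeometry.HyperbolicPolynomials.ElementarySymmetricCone
import HarnessLib

/-!
# The derivative cone of a hyperbolic polynomial (Renegar 2006, §4–§5)

Topic `Literature/AlgebraicGeometry/HyperbolicPolynomials`. For a form `f ∈ ℝ[x_σ]` of degree
`d ≥ 1`, hyperbolic w.r.t. `e`, the **derivative polynomial** in direction `e` is
`f'_e = D_e f = Σ_k e_k ∂_k f` (written out as `∑ k, e k • pderiv k f`; no new definition), and its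
closed hyperbolicity cone `Λ₊(f'_e, e)` is Renegar's **derivative cone** (derivative relaxation).
This file proves, in full:

* `sum_prod_erase_eq_eval_esymm` — the combinatorial identity `Σᵢ ∏_{j ≠ i} gⱼ = e_{n-1}(g)`.
* `exists_eigenvalues_eq_map` — an enumeration `v : Fin d → ℝ` of the eigenvalue multiset.
* `linePoly_eq_C_mul_prod` — `f(x + te) = f(e) ∏ᵢ (t + vᵢ)` as polynomials in `t`.
* `eval_sum_smul_pderiv_add_smul_eq_esymm` — **Renegar 2006, Proposition 18** (case `i = 1`,
  along the line): `f'_e(x + te) = f(e) · e_{d-1}(v + t𝟙)`.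
* `mem_hyperbolicityCone_sum_smul_pderiv_iff` — **the derivative cone in the eigenvalue picture**
  (Renegar 2006, Theorem 20 / eq. (3) with `i = 1`): `x ∈ Λ₊(f'_e, e) ↔ v ∈ Λ₊(e_{d-1}, 𝟙)`, i.e.
  the derivative cone is the preimage of the elementary symmetric cone `Λ₊(e_{d-1}^{(d)}, 𝟙)`
  (the first derivative relaxation of the orthant `ℝ^d_+`) under the eigenvalue map.
* `hyperbolicityCone_subset_sum_smul_pderiv` — **nesting** `Λ₊(f, e) ⊆ Λ₊(f'_e, e)` (Renegar §4:
  "the derivative cone is a relaxation").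
* `isHyperbolic_sum_smul_pderiv` — **`f'_e` is hyperbolic in direction `e`** (Renegar §4, by
  Rolle: `t ↦ f(x + te)` real-rooted ⇒ its derivative is real-rooted).

These are the structural facts behind Saunderson–Parrilo's recursions (their Prop. 2 is the
`f = e_d` instance, tree file `SpectrahedralShadowProofs`) and the starting point for lifted
representations of derivative relaxations in directions other than `𝟙`.

## References

* [Renegar2006] J. Renegar, *Hyperbolic programs, and their derivative relaxations*, Found.
  Comput. Math. 6 (2006) 59–79: §4 (derivative polynomial `p'_e`, hyperbolicity by Rolle,
  `Λ₊₊ ⊆ Λ'₊₊`), Proposition 18 (`p^{(i)}(x) = i! p(e) σ_{n-i}(λ(x))`), Theorem 20 and eq. (3)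
  (`Λ₊^{(i)} = {x : σ_k(λ(x)) ≥ 0, k ≤ n - i}`).
-/

noncomputable section

open MvPolynomial
open scoped BigOperators Polynomial

namespace Literature.AlgebraicGeometry.HyperbolicPolynomials

/-! ### A combinatorial identity -/

/-- `Σᵢ ∏_{j ≠ i} gⱼ = e_{n-1}(g₁, …, gₙ)` (`n = |ι| ≥ 1`): the complements of singletons are exactly
the `(n-1)`-subsets. [folklore] -/
theorem sum_prod_erase_eq_eval_esymm {ι : Type*} [Fintype ι] [DecidableEq ι] {R : Type*}
    [CommSemiring R] (g : ι → R) (hι : 1 ≤ Fintype.card ι) :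
    ∑ i, ∏ j ∈ Finset.univ.erase i, g j =
      MvPolynomial.eval g (esymm ι R (Fintype.card ι - 1)) := by
  classical
  rw [eval_esymm_eq_sum_powersetCard]
  have hne : Nonempty ι := Fintype.card_pos_iff.1 hι
  -- inverse map: the unique element missing from an `(n-1)`-subset
  let j : Finset ι → ι := fun S => if h : ∃ a, a ∉ S then h.choose else hne.some
  have hj_spec : ∀ S : Finset ι, (∃ a, a ∉ S) → j S ∉ S := fun S h => by
    simp only [j, dif_pos h]
    exact h.choose_spec
  refine Finset.sum_nbij' (fun i => Finset.univ.erase i) j (fun i _ => ?_) (fun S _ => Finset.mem_univ _)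
    (fun i _ => ?_) (fun S hS => ?_) (fun i _ => rfl)
  · exact Finset.mem_powersetCard.2 ⟨Finset.subset_univ _,
      by rw [Finset.card_erase_of_mem (Finset.mem_univ i), Finset.card_univ]⟩
  · have hex : ∃ a, a ∉ Finset.univ.erase i := ⟨i, Finset.notMem_erase i _⟩
    have hnot := hj_spec _ hex
    by_contra hne'
    exact hnot (Finset.mem_erase.2 ⟨hne', Finset.mem_univ _⟩)
  · obtain ⟨-, hcard⟩ := Finset.mem_powersetCard.1 hS
    have hex : ∃ a, a ∉ S := by
      by_contra hall
      push Not at hall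
      have hSu : S = Finset.univ := Finset.eq_univ_iff_forall.2 hall
      rw [hSu, Finset.card_univ] at hcard
      omega
    have hnot := hj_spec S hex
    symm
    refine Finset.eq_of_subset_of_card_le (fun a ha => Finset.mem_erase.2 ⟨?_, Finset.mem_univ a⟩) ?_
    · rintro rfl
      exact hnot ha
    · rw [Finset.card_erase_of_mem (Finset.mem_univ _), Finset.card_univ, hcard]

/-! ### Eigenvalue enumerations and the factorisation of the line polynomial -/

section Hyperbolic

variable {σ : Type*} [Fintype σ] {f : MvPolynomial σ ℝ} {d : ℕ} {e : σ → ℝ}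

omit [Fintype σ] in
/-- The eigenvalue multiset of `x` (of cardinality `d`) admits an enumeration `v : Fin d → ℝ`.
[folklore] -/
theorem exists_eigenvalues_eq_map (hf : f.IsHomogeneous d) (h : IsHyperbolic f e) (x : σ → ℝ) :
    ∃ v : Fin d → ℝ, Finset.univ.val.map v = eigenvalues f e x := by
  have hcard := card_eigenvalues hf h x
  set s := eigenvalues f e x
  have hl : s.toList.length = d := by rw [Multiset.length_toList, hcard]
  refine ⟨fun i => s.toList.get (i.cast hl.symm), ?_⟩
  rw [Fin.univ_val_map]
  have hofFn : List.ofFn (fun i : Fin d => s.toList.get (i.cast hl.symm)) = s.toList := by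
    apply List.ext_get (by simp [hl])
    intro n h1 h2
    simp only [List.getElem_ofFn, List.get_eq_getElem, Fin.val_cast]
    rfl
  rw [hofFn, Multiset.coe_toList]

omit [Fintype σ] in
/-- **`f(x + te) = f(e) ∏ᵢ (t + vᵢ)` as polynomials in `t`**, for an enumeration `v` of the
eigenvalues of `x`. [cite: Renegar2006, §2] -/
theorem linePoly_eq_C_mul_prod (hf : f.IsHomogeneous d) (h : IsHyperbolic f e) (x : σ → ℝ)
    {v : Fin d → ℝ} (hv : Finset.univ.val.map v = eigenvalues f e x) :
    linePoly f x e = Polynomial.C (MvPolynomial.eval e f) *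
      ∏ i : Fin d, (Polynomial.X + Polynomial.C (v i)) := by
  have hfac := Polynomial.C_leadingCoeff_mul_prod_multiset_X_sub_C (h.card_roots_linePoly x)
  rw [leadingCoeff_linePoly hf h.eval_ne_zero] at hfac
  rw [← hfac]
  congr 1
  have hroots : (linePoly f x e).roots = (eigenvalues f e x).map fun lam => -lam := by
    rw [eigenvalues, Multiset.map_map]
    simp
  rw [hroots, ← hv, Multiset.map_map, Multiset.map_map, Finset.prod_eq_multiset_prod]
  refine congrArg Multiset.prod (Multiset.map_congr rfl fun i _ => ?_)
  simp [sub_eq_add_neg]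

/-- **Renegar 2006, Proposition 18 (`i = 1`), along the line, product form**:
`f'_e(x + te) = f(e) Σᵢ ∏_{j ≠ i} (t + vⱼ)`. [cite: Renegar2006, Proposition 18] -/
theorem eval_sum_smul_pderiv_add_smul (hf : f.IsHomogeneous d) (h : IsHyperbolic f e) (x : σ → ℝ)
    {v : Fin d → ℝ} (hv : Finset.univ.val.map v = eigenvalues f e x) (t : ℝ) :
    MvPolynomial.eval (x + t • e) (∑ k, e k • pderiv k f) =
      MvPolynomial.eval e f * ∑ i : Fin d, ∏ j ∈ Finset.univ.erase i, (t + v j) := by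
  classical
  rw [← eval_linePoly, ← derivative_linePoly, linePoly_eq_C_mul_prod hf h x hv,
    Polynomial.derivative_mul, Polynomial.derivative_C, zero_mul, zero_add,
    Polynomial.derivative_prod_finset]
  simp [Polynomial.eval_finsetSum, Polynomial.eval_prod]

/-- **Renegar 2006, Proposition 18 (`i = 1`), along the line**: for a form `f` of degree `d ≥ 1`
hyperbolic w.r.t. `e` and an enumeration `v` of the eigenvalues of `x`,
`f'_e(x + te) = f(e) · e_{d-1}(v + t𝟙)` ("`p'(x) = p(e) σ_{n-1}(λ(x))`", applied at `x + te`, whose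
eigenvalues are `λ(x) + t`). [cite: Renegar2006, Proposition 18] -/
theorem eval_sum_smul_pderiv_add_smul_eq_esymm (hf : f.IsHomogeneous d) (h : IsHyperbolic f e)
    (hd : 1 ≤ d) (x : σ → ℝ) {v : Fin d → ℝ} (hv : Finset.univ.val.map v = eigenvalues f e x)
    (t : ℝ) :
    MvPolynomial.eval (x + t • e) (∑ k, e k • pderiv k f) =
      MvPolynomial.eval e f *
        MvPolynomial.eval (v + t • fun _ => (1 : ℝ)) (esymm (Fin d) ℝ (d - 1)) := by
  classical
  rw [eval_sum_smul_pderiv_add_smul hf h x hv t]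
  congr 1
  have key := sum_prod_erase_eq_eval_esymm (fun j => t + v j) (by simpa using hd)
  simp only [Fintype.card_fin] at key
  have hvec : (fun j => t + v j) = v + t • fun _ => (1 : ℝ) := by
    funext j
    simp [add_comm]
  rw [key, hvec]

/-- **The derivative cone in the eigenvalue picture** (Renegar 2006, Theorem 20 and eq. (3) with
`i = 1`: `Λ'₊ = {x : σ_k(λ(x)) ≥ 0, k ≤ n-1}` = the preimage of `Λ₊(e_{n-1}, 𝟙)` under `λ`): for a
form `f` of degree `d ≥ 1` hyperbolic w.r.t. `e` and an enumeration `v` of the eigenvalues of `x`,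
`x ∈ Λ₊(f'_e, e) ↔ v ∈ Λ₊(e_{d-1}^{(d)}, 𝟙)`. [cite: Renegar2006, Theorem 20] -/
theorem mem_hyperbolicityCone_sum_smul_pderiv_iff (hf : f.IsHomogeneous d) (h : IsHyperbolic f e)
    (hd : 1 ≤ d) (x : σ → ℝ) {v : Fin d → ℝ} (hv : Finset.univ.val.map v = eigenvalues f e x) :
    x ∈ hyperbolicityCone (∑ k, e k • pderiv k f) e ↔
      v ∈ hyperbolicityCone (esymm (Fin d) ℝ (d - 1)) (fun _ => (1 : ℝ)) := by
  simp only [mem_hyperbolicityCone_iff, eval_sum_smul_pderiv_add_smul_eq_esymm hf h hd x hv,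
    ne_eq, mul_eq_zero, h.eval_ne_zero, false_or]

/-- **Nesting** (Renegar 2006, §4: "`Λ₊₊ ⊆ Λ'₊₊`, i.e., the derivative cone is a relaxation"):
`Λ₊(f, e) ⊆ Λ₊(f'_e, e)`. [cite: Renegar2006, §4] -/
theorem hyperbolicityCone_subset_sum_smul_pderiv (hf : f.IsHomogeneous d) (h : IsHyperbolic f e)
    (hd : 1 ≤ d) :
    hyperbolicityCone f e ⊆ hyperbolicityCone (∑ k, e k • pderiv k f) e := by
  intro x hx
  obtain ⟨v, hv⟩ := exists_eigenvalues_eq_map hf h x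
  rw [mem_hyperbolicityCone_sum_smul_pderiv_iff hf h hd x hv]
  have hnn : ∀ i, 0 ≤ v i := fun i =>
    (mem_hyperbolicityCone_iff_eigenvalues_nonneg hf h x).1 hx (v i)
      (by rw [← hv]; exact Multiset.mem_map_of_mem _ (Finset.mem_univ_val i))
  exact mem_hyperbolicityCone_esymm_of_nonneg (by simp) hnn

/-- Euler along the direction: `f'_e(e) = d · f(e)`. [folklore] -/
theorem eval_sum_smul_pderiv_self (hf : f.IsHomogeneous d) (e : σ → ℝ) :
    MvPolynomial.eval e (∑ k, e k • pderiv k f) = d * MvPolynomial.eval e f := by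
  have hE := congrArg (MvPolynomial.eval e) hf.sum_X_mul_pderiv
  simp only [map_sum, map_mul, MvPolynomial.eval_X, nsmul_eq_mul, map_natCast] at hE
  rw [← hE, map_sum]
  refine Finset.sum_congr rfl fun k _ => ?_
  rw [MvPolynomial.smul_eq_C_mul, map_mul, MvPolynomial.eval_C]

/-- **The derivative polynomial is hyperbolic in direction `e`** (Renegar 2006, §4: between two
roots of `t ↦ p(x + te)` lies a root of its derivative, which has exactly one root less, so
real-rootedness is inherited; and `p'_e(e) = n p(e) ≠ 0`). [cite: Renegar2006, §4] -/
theorem isHyperbolic_sum_smul_pderiv (hf : f.IsHomogeneous d) (h : IsHyperbolic f e) (hd : 1 ≤ d) :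
    IsHyperbolic (∑ k, e k • pderiv k f) e := by
  classical
  rw [isHyperbolic_iff_linePoly]
  refine ⟨?_, fun x z hz => ?_⟩
  · rw [eval_sum_smul_pderiv_self hf e]
    exact mul_ne_zero (by exact_mod_cast (show d ≠ 0 by omega)) h.eval_ne_zero
  · -- `linePoly f'_e x e = (linePoly f x e)'` has `d - 1` real roots, i.e. all of them
    set q := linePoly f x e with hq
    have hq' : linePoly (∑ k, e k • pderiv k f) x e = Polynomial.derivative q :=
      (derivative_linePoly f x e).symm
    rw [hq'] at hz
    have hqdeg : q.natDegree = d := natDegree_linePoly hf h.eval_ne_zero x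
    have hqroots : Multiset.card q.roots = d := by rw [h.card_roots_linePoly x, hqdeg]
    -- the derivative is nonzero (degree `d ≥ 1`, characteristic zero)
    have hq'ne : Polynomial.derivative q ≠ 0 := by
      intro h0
      have := Polynomial.derivative_eq_zero.1 h0
      omega
    -- it has `natDegree` many real roots
    have hle1 : Multiset.card q.roots ≤ Multiset.card (Polynomial.derivative q).roots + 1 :=
      Polynomial.card_roots_le_derivative q
    have hle2 : Multiset.card (Polynomial.derivative q).roots ≤ (Polynomial.derivative q).natDegree :=
      Polynomial.card_roots' _
    have hle3 : (Polynomial.derivative q).natDegree ≤ q.natDegree - 1 :=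
      Polynomial.natDegree_derivative_le q
    have hcardq' : Multiset.card (Polynomial.derivative q).roots =
        (Polynomial.derivative q).natDegree := by omega
    -- hence all complex roots of the complexification are real
    have hmapne : (Polynomial.derivative q).map (algebraMap ℝ ℂ) ≠ 0 :=
      (Polynomial.map_ne_zero_iff (algebraMap ℝ ℂ).injective).2 hq'ne
    have hsub : (Polynomial.derivative q).roots.map (algebraMap ℝ ℂ) ≤
        ((Polynomial.derivative q).map (algebraMap ℝ ℂ)).roots :=
      Polynomial.map_roots_le hmapne
    have hcardC : Multiset.card ((Polynomial.derivative q).map (algebraMap ℝ ℂ)).roots ≤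
        Multiset.card ((Polynomial.derivative q).roots.map (algebraMap ℝ ℂ)) := by
      rw [Multiset.card_map, hcardq', ← Polynomial.natDegree_map (algebraMap ℝ ℂ)]
      exact Polynomial.card_roots' _
    have heq := Multiset.eq_of_le_of_card_le hsub hcardC
    have hzmem : z ∈ ((Polynomial.derivative q).map (algebraMap ℝ ℂ)).roots :=
      (Polynomial.mem_roots hmapne).2 hz
    rw [← heq, Multiset.mem_map] at hzmem
    obtain ⟨r, -, rfl⟩ := hzmem
    simp

end Hyperbolic

end Literature.AlgebraicGeometry.HyperbolicPolynomials

end
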